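import Mathlib
import HarnessLib
import Summits.Ventures.LatticeQCDFlow.Exactness.U1SubstepForceLipschitzTransfer
import Summits.Ventures.LatticeQCDFlow.Exactness.U1WilsonFlowLOSmooth

/-!
# `U(1)` rung: THE ENGINE'S EXACT (autodiff) FORCE THROUGH THE WHOLE LO WILSON-FLOW MEMBER IS BOUNDED AND LIPSCHITZ WITH EXPLICIT, VOLUME-INDEPENDENT CONSTANTS — any schedule, by induction over the layers

HONEST FRAMING: exact (Metropolis-corrected) sampling algorithms for lattice gauge theory;
figures of merit are autocorrelation/cost numbers at stated couplings and volumes; no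
continuum-physics claim.

Venture `LatticeQCDFlow` (cell pub-lqcd), topic `Exactness`; FANOUT row 14 (`eng-flowhmc`, engine
`latflow.fthmc`, family B, `U(1)` rung: FT-HMC force = `κ · fderiv (p ↦ S̃(e^(icp)·V)) 0 (δ_e)`,
`S̃ = β S_W∘F − log J`, `F, J` the LO member = ANY schedule of masked Wilson-flow sub-steps packaged
VERBATIM as in `exists_layers_u1WilsonFlowLO`).  NEW WORK of the cell over this row's one-layer
transfer (`U1SubstepForceTransfer`, `U1SubstepForceLipschitzTransfer` — whose §2 has the real bookkeeping
steps `u1ForceBound_step` / `u1ForceLipschitz_step` of the two recursions run here), GEN-11's `U1ExactForceWilson`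
(base case: the exact force of `β S_W` is `−βcκ·Z`), GEN-12's `U1WilsonForceLipschitz` (`|Z| ≤ 2(d−1)`,
`Z` is `8(d−1)`-Lipschitz); nothing is cited as a fact; no number.  THIS CLOSES the item every FT file of
the row listed as NOT CLAIMED — "the Lipschitz constant of the engine's autodiff force THROUGH the
member (taken abstractly)".

* **`u1WilsonFlowLO_member_exactForce_bounds`** — `L ≥ 2`, `2(d−1)|ε| < 1`, positive booked densities;
  for every `β, c, κ` and every schedule of `n` layers, with
  `A = 8(d−1)|ε|`, `m = 1 − 2(d−1)|ε|`, `b₀ = 2(d−1)|βcκ|`, `K₀ = 8(d−1)|βcκ|`,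
  `u = |κ||c||ε|·8(d−1)/m`, `w = |κ||c||ε|(32(d−1)/m + 64(d−1)²|ε|/m²)`:
  (i) `p ↦ S̃(e^(icp)·V)` is differentiable at `0` for every `V`;
  (ii) `|g(V)(e)| ≤ (1+A)^n (b₀ + n u)`;
  (iii) `|g(V)(e) − g(V')(e)| ≤ (1+A)^(2n) (K₀ + n (4A(b₀ + n u) + w)) · dist(V, V')`
  — uniformly in the volume `L^d`.

NOT CLAIMED: sharpness (the constants are what the crude incidence bounds give); `L = 1`; `SU(2)`;
learned members; floating point; any number.
-/

noncomputable section

namespace Summit.Ventures.LatticeQCDFlow.Exactness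

open MeasureTheory
open Literature.MathematicalPhysics.QuantumFieldTheory Literature.MathematicalPhysics.QuantumLattice
open scoped BigOperators

variable {d L : ℕ} {X : Type*} [DecidableEq X] (χ : Site d L → X) [NeZero L]

/-! ## The member -/

/-- **THE EXACT FORCE THROUGH THE `U(1)` LO MEMBER: DIFFERENTIABLE, BOUNDED, LIPSCHITZ — EXPLICITLY AND
UNIFORMLY IN THE VOLUME** (see the module docstring for the constants). -/
theorem u1WilsonFlowLO_member_exactForce_bounds (hL : 2 ≤ L) {ε : ℝ}
    (hε : |ε| * (2 * ((d - 1 : ℕ) : ℝ)) < 1) (sched : List (Fin d × X))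
    (layers : List ((GaugeConfig d L Circle ≃ᵐ GaugeConfig d L Circle) × (GaugeConfig d L Circle → ℝ)))
    (hmap :
      layers.map (fun Ly => ((Ly.1 : GaugeConfig d L Circle → GaugeConfig d L Circle), Ly.2)) = sched.map (fun s =>
        ((fun (V : GaugeConfig d L Circle) (e : Edge d L) => if e.2 = s.1 ∧ χ e.1 = s.2 then
          V e * Circle.exp (ε * ∑ ν ∈ Finset.univ.erase e.2,
            (((plaquetteHolonomy V (e.1 - Pi.single ν 1) e.2 ν : Circle) : ℂ).im -
              ((plaquetteHolonomy V e.1 e.2 ν : Circle) : ℂ).im)) else V e),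
         fun V : GaugeConfig d L Circle => ∏ a : {e : Edge d L // e.2 = s.1 ∧ χ e.1 = s.2},
          (1 - ε * ∑ ν ∈ Finset.univ.erase a.1.2,
            (((plaquetteHolonomy V a.1.1 a.1.2 ν : Circle) : ℂ).re +
              ((plaquetteHolonomy V (a.1.1 - Pi.single ν 1) a.1.2 ν : Circle) : ℂ).re)))))
    (hpos : ∀ Ly ∈ layers, ∀ V, 0 < Ly.2 V) (β c κ : ℝ) :
    (∀ V : GaugeConfig d L Circle, DifferentiableAt ℝ (fun p : (Edge d L → ℝ) =>
      (fun W : GaugeConfig d L Circle => β * wilsonAction u1Rep ((layers.foldr (fun Ly (F : GaugeConfig d L Circle ≃ᵐ GaugeConfig d L Circle) => Ly.1.trans F) (MeasurableEquiv.refl (GaugeConfig d L Circle))) W) - Real.log ((layers.foldr (fun Ly K => fun v => Ly.2 v * K (Ly.1 v)) (fun _ => (1 : ℝ))) W)) ((fun i : Edge d L => Circle.exp (c * p i)) * V)) 0) ∧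
    (∀ (V : GaugeConfig d L Circle) (e : Edge d L),
      |κ * fderiv ℝ (fun p : (Edge d L → ℝ) =>
        (fun W : GaugeConfig d L Circle => β * wilsonAction u1Rep ((layers.foldr (fun Ly (F : GaugeConfig d L Circle ≃ᵐ GaugeConfig d L Circle) => Ly.1.trans F) (MeasurableEquiv.refl (GaugeConfig d L Circle))) W) - Real.log ((layers.foldr (fun Ly K => fun v => Ly.2 v * K (Ly.1 v)) (fun _ => (1 : ℝ))) W)) ((fun i : Edge d L => Circle.exp (c * p i)) * V)) 0 (Pi.single e 1)| ≤
      (1 + 8 * ((d - 1 : ℕ) : ℝ) * |ε|) ^ sched.length *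
        (2 * ((d - 1 : ℕ) : ℝ) * |β * c * κ| + (sched.length : ℝ) *
          (|κ| * |c| * |ε| * (8 * ((d - 1 : ℕ) : ℝ)) / (1 - |ε| * (2 * ((d - 1 : ℕ) : ℝ)))))) ∧
    (∀ (V V' : GaugeConfig d L Circle) (e : Edge d L),
      |κ * fderiv ℝ (fun p : (Edge d L → ℝ) =>
        (fun W : GaugeConfig d L Circle => β * wilsonAction u1Rep ((layers.foldr (fun Ly (F : GaugeConfig d L Circle ≃ᵐ GaugeConfig d L Circle) => Ly.1.trans F) (MeasurableEquiv.refl (GaugeConfig d L Circle))) W) - Real.log ((layers.foldr (fun Ly K => fun v => Ly.2 v * K (Ly.1 v)) (fun _ => (1 : ℝ))) W)) ((fun i : Edge d L => Circle.exp (c * p i)) * V)) 0 (Pi.single e 1) -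
       κ * fderiv ℝ (fun p : (Edge d L → ℝ) =>
        (fun W : GaugeConfig d L Circle => β * wilsonAction u1Rep ((layers.foldr (fun Ly (F : GaugeConfig d L Circle ≃ᵐ GaugeConfig d L Circle) => Ly.1.trans F) (MeasurableEquiv.refl (GaugeConfig d L Circle))) W) - Real.log ((layers.foldr (fun Ly K => fun v => Ly.2 v * K (Ly.1 v)) (fun _ => (1 : ℝ))) W)) ((fun i : Edge d L => Circle.exp (c * p i)) * V')) 0 (Pi.single e 1)| ≤
      (1 + 8 * ((d - 1 : ℕ) : ℝ) * |ε|) ^ (2 * sched.length) *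
        (8 * ((d - 1 : ℕ) : ℝ) * |β * c * κ| + (sched.length : ℝ) *
          (4 * (8 * ((d - 1 : ℕ) : ℝ) * |ε|) *
            (2 * ((d - 1 : ℕ) : ℝ) * |β * c * κ| + (sched.length : ℝ) *
              (|κ| * |c| * |ε| * (8 * ((d - 1 : ℕ) : ℝ)) / (1 - |ε| * (2 * ((d - 1 : ℕ) : ℝ))))) +
           |κ| * |c| * |ε| * (32 * ((d - 1 : ℕ) : ℝ) / (1 - |ε| * (2 * ((d - 1 : ℕ) : ℝ))) +
             64 * ((d - 1 : ℕ) : ℝ) ^ 2 * |ε| / (1 - |ε| * (2 * ((d - 1 : ℕ) : ℝ))) ^ 2))) * dist V V') := by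
  -- abbreviations for the constants (real numbers)
  have hm : 0 < 1 - |ε| * (2 * ((d - 1 : ℕ) : ℝ)) := by linarith
  have hA0 : 0 ≤ 8 * ((d - 1 : ℕ) : ℝ) * |ε| := by positivity
  have h1A : 1 ≤ 1 + 8 * ((d - 1 : ℕ) : ℝ) * |ε| := by linarith
  have hu0 : 0 ≤ |κ| * |c| * |ε| * (8 * ((d - 1 : ℕ) : ℝ)) / (1 - |ε| * (2 * ((d - 1 : ℕ) : ℝ))) := by
    positivity
  have hw0 : 0 ≤ |κ| * |c| * |ε| * (32 * ((d - 1 : ℕ) : ℝ) / (1 - |ε| * (2 * ((d - 1 : ℕ) : ℝ))) +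
      64 * ((d - 1 : ℕ) : ℝ) ^ 2 * |ε| / (1 - |ε| * (2 * ((d - 1 : ℕ) : ℝ))) ^ 2) := by positivity
  have hb0 : 0 ≤ 2 * ((d - 1 : ℕ) : ℝ) * |β * c * κ| := by positivity
  induction sched generalizing layers with
  | nil =>
    have hnil : layers = [] := by
      have h := congrArg List.length hmap
      simp only [List.length_map, List.length_nil] at h
      exact List.eq_nil_of_length_eq_zero h
    subst hnil
    -- the member is the identity: the action is `β·S_W`
    have hfun : ∀ V : GaugeConfig d L Circle, (fun p : (Edge d L → ℝ) =>
        (fun W : GaugeConfig d L Circle => β * wilsonAction u1Rep ((([] : List ((GaugeConfig d L Circle ≃ᵐ GaugeConfig d L Circle) × (GaugeConfig d L Circle → ℝ))).foldr (fun Ly (F : GaugeConfig d L Circle ≃ᵐ GaugeConfig d L Circle) => Ly.1.trans F) (MeasurableEquiv.refl (GaugeConfig d L Circle))) W) - Real.log ((([] : List ((GaugeConfig d L Circle ≃ᵐ GaugeConfig d L Circle) × (GaugeConfig d L Circle → ℝ))).foldr (fun Ly K => fun v => Ly.2 v * K (Ly.1 v)) (fun _ => (1 : ℝ))) W)) ((fun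 i : Edge d L => Circle.exp (c * p i)) * V)) =
        fun p : (Edge d L → ℝ) => (fun W : GaugeConfig d L Circle => β * wilsonAction u1Rep W)
          ((fun i : Edge d L => Circle.exp (c * p i)) * V) := by
      intro V
      funext p
      simp only [List.foldr_nil, MeasurableEquiv.refl_apply, Real.log_one, sub_zero]
    have hforce : ∀ (V : GaugeConfig d L Circle) (e : Edge d L),
        κ * fderiv ℝ (fun p : (Edge d L → ℝ) => (fun W : GaugeConfig d L Circle => β * wilsonAction u1Rep W)
          ((fun i : Edge d L => Circle.exp (c * p i)) * V)) 0 (Pi.single e 1) =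
        -(β * c * κ) * ∑ ν ∈ Finset.univ.erase e.2,
            (((plaquetteHolonomy V (e.1 - Pi.single ν 1) e.2 ν : Circle) : ℂ).im -
              ((plaquetteHolonomy V e.1 e.2 ν : Circle) : ℂ).im) :=
      fun V e => congrFun (congrFun (u1ExactForceRoutine_eq_flowField (d := d) (L := L) hL β c κ) V) e
    refine ⟨fun V => ?_, fun V e => ?_, fun V V' e => ?_⟩
    · rw [hfun V]
      exact differentiableAt_wilsonAction_circleDrift β c V 0
    · rw [hfun V, hforce V e]
      simp only [List.length_nil, pow_zero, Nat.cast_zero, zero_mul, add_zero, one_mul]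
      rw [abs_mul, abs_neg]
      calc |β * c * κ| * _ ≤ |β * c * κ| * (2 * ((d - 1 : ℕ) : ℝ)) :=
            mul_le_mul_of_nonneg_left (abs_u1FlowField_le V e) (abs_nonneg _)
        _ = 2 * ((d - 1 : ℕ) : ℝ) * |β * c * κ| := by ring
    · rw [hfun V, hfun V', hforce V e, hforce V' e]
      simp only [List.length_nil, mul_zero, pow_zero, Nat.cast_zero, zero_mul, add_zero, one_mul]
      rw [← mul_sub, abs_mul, abs_neg]
      calc |β * c * κ| * _ ≤ |β * c * κ| * (8 * ((d - 1 : ℕ) : ℝ) * dist V V') :=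
            mul_le_mul_of_nonneg_left (abs_u1FlowField_sub_le V V' e) (abs_nonneg _)
        _ = 8 * ((d - 1 : ℕ) : ℝ) * |β * c * κ| * dist V V' := by ring
  | cons s rest ih =>
    obtain ⟨Ly, layers', rfl⟩ : ∃ Ly layers', layers = Ly :: layers' := by
      cases layers with
      | nil => simp at hmap
      | cons Ly layers' => exact ⟨Ly, layers', rfl⟩
    rw [List.map_cons, List.map_cons, List.cons.injEq] at hmap
    obtain ⟨hLy, hrest⟩ := hmap
    have hF : (Ly.1 : GaugeConfig d L Circle → GaugeConfig d L Circle) = (fun (V : GaugeConfig d L Circle) (e : Edge d L) => if e.2 = s.1 ∧ χ e.1 = s.2 then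
          V e * Circle.exp (ε * ∑ ν ∈ Finset.univ.erase e.2,
            (((plaquetteHolonomy V (e.1 - Pi.single ν 1) e.2 ν : Circle) : ℂ).im -
              ((plaquetteHolonomy V e.1 e.2 ν : Circle) : ℂ).im)) else V e) := (Prod.mk.inj hLy).1
    have hJ : Ly.2 = fun V : GaugeConfig d L Circle => ∏ a : {e : Edge d L // e.2 = s.1 ∧ χ e.1 = s.2},
          (1 - ε * ∑ ν ∈ Finset.univ.erase a.1.2,
            (((plaquetteHolonomy V a.1.1 a.1.2 ν : Circle) : ℂ).re +
              ((plaquetteHolonomy V (a.1.1 - Pi.single ν 1) a.1.2 ν : Circle) : ℂ).re)) := (Prod.mk.inj hLy).2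
    have hpos' : ∀ L' ∈ layers', ∀ V, 0 < L'.2 V := fun L' hL' => hpos L' (List.mem_cons_of_mem _ hL')
    obtain ⟨hdiff', hB', hK'⟩ := ih layers' hrest hpos'
    -- peel the first layer: `S̃ = S̃' ∘ f − log J`
    have hfun : ∀ V : GaugeConfig d L Circle, (fun p : (Edge d L → ℝ) =>
        (fun W : GaugeConfig d L Circle => β * wilsonAction u1Rep (((Ly :: layers').foldr (fun Ly (F : GaugeConfig d L Circle ≃ᵐ GaugeConfig d L Circle) => Ly.1.trans F) (MeasurableEquiv.refl (GaugeConfig d L Circle))) W) - Real.log (((Ly :: layers').foldr (fun Ly K => fun v => Ly.2 v * K (Ly.1 v)) (fun _ => (1 : ℝ))) W)) ((fun i : Edge d L => Circle.exp (c * p i)) * V)) =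
        fun p : (Edge d L → ℝ) =>
          (fun W : GaugeConfig d L Circle => β * wilsonAction u1Rep ((layers'.foldr (fun Ly (F : GaugeConfig d L Circle ≃ᵐ GaugeConfig d L Circle) => Ly.1.trans F) (MeasurableEquiv.refl (GaugeConfig d L Circle))) W) - Real.log ((layers'.foldr (fun Ly K => fun v => Ly.2 v * K (Ly.1 v)) (fun _ => (1 : ℝ))) W))
            ((fun (V : GaugeConfig d L Circle) (e : Edge d L) => if e.2 = s.1 ∧ χ e.1 = s.2 then
              V e * Circle.exp (ε * ∑ ν ∈ Finset.univ.erase e.2,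
                (((plaquetteHolonomy V (e.1 - Pi.single ν 1) e.2 ν : Circle) : ℂ).im -
                  ((plaquetteHolonomy V e.1 e.2 ν : Circle) : ℂ).im)) else V e)
              ((fun i : Edge d L => Circle.exp (c * p i)) * V)) -
          Real.log ((fun V : GaugeConfig d L Circle =>
            ∏ a : {e : Edge d L // e.2 = s.1 ∧ χ e.1 = s.2},
              (1 - ε * ∑ ν ∈ Finset.univ.erase a.1.2,
                (((plaquetteHolonomy V a.1.1 a.1.2 ν : Circle) : ℂ).re +
                  ((plaquetteHolonomy V (a.1.1 - Pi.single ν 1) a.1.2 ν : Circle) : ℂ).re)))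
            ((fun i : Edge d L => Circle.exp (c * p i)) * V)) := by
      intro V
      funext p
      simp only [List.foldr_cons, MeasurableEquiv.trans_apply, hF, hJ]
      rw [Real.log_mul (Finset.prod_pos fun a _ => u1Factor_pos (d := d) (L := L) hε _ a.1).ne'
        (foldr_logDet_pos layers' hpos' _).ne']
      ring
    have hlen : (s :: rest).length = rest.length + 1 := List.length_cons
    have hK0 : 0 ≤ (1 + 8 * ((d - 1 : ℕ) : ℝ) * |ε|) ^ (2 * rest.length) *
        (8 * ((d - 1 : ℕ) : ℝ) * |β * c * κ| + (rest.length : ℝ) *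
          (4 * (8 * ((d - 1 : ℕ) : ℝ) * |ε|) *
            (2 * ((d - 1 : ℕ) : ℝ) * |β * c * κ| + (rest.length : ℝ) *
              (|κ| * |c| * |ε| * (8 * ((d - 1 : ℕ) : ℝ)) / (1 - |ε| * (2 * ((d - 1 : ℕ) : ℝ))))) +
           |κ| * |c| * |ε| * (32 * ((d - 1 : ℕ) : ℝ) / (1 - |ε| * (2 * ((d - 1 : ℕ) : ℝ))) +
             64 * ((d - 1 : ℕ) : ℝ) ^ 2 * |ε| / (1 - |ε| * (2 * ((d - 1 : ℕ) : ℝ))) ^ 2))) := by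
      positivity
    have hK00 : 0 ≤ 8 * ((d - 1 : ℕ) : ℝ) * |β * c * κ| := by positivity
    refine ⟨fun V => ?_, fun V e => ?_, fun V V' e => ?_⟩
    · rw [hfun V]
      exact differentiableAt_ftAction_u1Substep χ s.1 s.2 hε c
        (S' := fun W : GaugeConfig d L Circle => β * wilsonAction u1Rep ((layers'.foldr (fun Ly (F : GaugeConfig d L Circle ≃ᵐ GaugeConfig d L Circle) => Ly.1.trans F) (MeasurableEquiv.refl (GaugeConfig d L Circle))) W) - Real.log ((layers'.foldr (fun Ly K => fun v => Ly.2 v * K (Ly.1 v)) (fun _ => (1 : ℝ))) W)) hdiff' V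
    · rw [hfun V, hlen]
      exact (abs_u1ExactForce_substep_le χ s.1 s.2 hε c κ
        (S' := fun W : GaugeConfig d L Circle => β * wilsonAction u1Rep ((layers'.foldr (fun Ly (F : GaugeConfig d L Circle ≃ᵐ GaugeConfig d L Circle) => Ly.1.trans F) (MeasurableEquiv.refl (GaugeConfig d L Circle))) W) - Real.log ((layers'.foldr (fun Ly K => fun v => Ly.2 v * K (Ly.1 v)) (fun _ => (1 : ℝ))) W)) hdiff' hB' V e).trans
        (u1ForceBound_step rest.length hA0 hu0)
    · rw [hfun V, hfun V', hlen]
      exact (abs_u1ExactForce_substep_sub_le χ s.1 s.2 hε c κ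
        (S' := fun W : GaugeConfig d L Circle => β * wilsonAction u1Rep ((layers'.foldr (fun Ly (F : GaugeConfig d L Circle ≃ᵐ GaugeConfig d L Circle) => Ly.1.trans F) (MeasurableEquiv.refl (GaugeConfig d L Circle))) W) - Real.log ((layers'.foldr (fun Ly K => fun v => Ly.2 v * K (Ly.1 v)) (fun _ => (1 : ℝ))) W)) hK0 hdiff' hB' hK' V V' e).trans
        (u1ForceLipschitz_step rest.length hA0 hu0 hw0 hb0 dist_nonneg (by ring))

end Summit.Ventures.LatticeQCDFlow.Exactness
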